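import Literature.NumberTheory.ModularForms.SturmCongruenceLevelOne
import Literature.NumberTheory.EllipticCurves.ModularCurveSturmProofs
import Literature.NumberTheory.EllipticCurves.ModularCurveGammaIndex
import Mathlib.NumberTheory.ModularForms.NormTrace
import HarnessLib

/-!
# Sturm's congruence theorem for `Γ₁(N)` from the level-one case: the norm argument

Topic `Literature/NumberTheory/ModularForms`.  THEOREMS ONLY (no definition, no named fact); the
second step of the discharge of
`Literature.NumberTheory.ModularForms.Sturm1987_congruence_modPrime_gamma1` (`SturmCongruence.lean`),
following M. Ram Murty, *Congruences between modular forms* (1997), §4 (= Sturm 1987, proof of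
Thm. 1): for `f ∈ M_k(Γ₁(N))` with integer coefficients `zₙ` at `∞`, form the "norm"
`Φ = f · ∏_{r ≠ 1} A_r (f|r⁻¹)` over coset representatives `r` of `Γ₁(N)` in `SL₂(ℤ)`
(Mathlib `ModularForm.norm 𝒮ℒ f`, a level-one form of weight `k·[SL₂(ℤ) : Γ₁(N)]`), where the
constants `A_r` normalise the translates to have `q_N`-expansions with coefficients in a subring
`R ⊆ ℂ` and non-zero reduction modulo a prime `P ⊆ R` containing `p` (hypothesis `htr` of
`dvd_of_translates_of_dvd`; it is supplied from the bounded denominators of the translates in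
`SturmCongruenceProofs.lean`).  If `p ∣ zₙ` for `n ≤ k[SL₂(ℤ) : Γ₁(N)]/12` but some `z_{n₀}` is prime
to `p`, the `q_N`-expansion of `Φ` is a product of series over `R` with non-zero reductions in the
domain `(R ⧸ P)⟦X⟧`, one of which (that of `f`) is divisible by `X^{N(⌊km/12⌋+1)}`; reading it as a
`q`-expansion of the level-one form `Φ` (coefficients at the multiples of `N`,
`coeff_qExpansion_nat_eq`) contradicts the level-one congruence theorem
`levelOne_map_toSubring_qExpansion_eq_zero`.

* `exists_modularForm_Gamma_coe_eq_slash` — `f ∣_k r ∈ M_k(Γ(N))` for `r ∈ SL₂(ℤ)` (`Γ(N)` is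
  normal in `SL₂(ℤ)` and contained in `Γ₁(N)`);
* `qExpansion_finset_prod` — `q`-expansions of finite products of functions;
* `coeff_qExpansion_nat_eq` — the `q_N`-expansion of a `1`-periodic form is its `q`-expansion in
  `q = q_N^N`;
* `dvd_of_translates_of_dvd` — the norm argument.

## References

* [Murty1997] M. Ram Murty, *Congruences between modular forms*, Analytic Number Theory (Kyoto
  1996), LMS Lecture Note Ser. 247 (1997), 309–320, §2 (`ord_𝔭(fg) = ord_𝔭 f + ord_𝔭 g`), §4.
* [Sturm1987] J. Sturm, *On the congruence of modular forms*, LNM 1240 (1987), 275–280, Thm. 1.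
-/

noncomputable section

namespace Literature.NumberTheory.ModularForms

open scoped MatrixGroups ModularForm
open UpperHalfPlane ModularForm SlashInvariantForm PowerSeries CongruenceSubgroup
  Matrix.SpecialLinearGroup
open Literature.NumberTheory.EllipticCurves.ModularForms (card_quotient_subgroupOf_eq_index
  exists_coe_rangeRestrict_eq quotientFunc_coe_rangeRestrict Gamma_le_Gamma1)

/-! ### Translates of a form on `Γ₁(N)` are forms on `Γ(N)` -/

section Translates

/-- `N` is a strict period of `Γ(N)` (Mathlib `strictPeriods_Gamma`). [folklore] -/
theorem natCast_mem_strictPeriods_Gamma (N : ℕ) :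
    ((N : ℕ) : ℝ) ∈ (Gamma N : Subgroup (GL (Fin 2) ℝ)).strictPeriods := by
  rw [strictPeriods_Gamma]
  exact AddSubgroup.mem_zmultiples _

/-- `N` is a strict period of every level `Γ ∋ T` with `strictPeriods Γ = ℤ · 1`, e.g. `SL₂(ℤ)`
and `Γ₁(N)`. [folklore] -/
theorem natCast_mem_of_eq_zmultiples_one {Γ : Subgroup (GL (Fin 2) ℝ)}
    (h : Γ.strictPeriods = AddSubgroup.zmultiples 1) (n : ℕ) : ((n : ℕ) : ℝ) ∈ Γ.strictPeriods := by
  rw [h]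
  simpa using (AddSubgroup.zmultiples (1 : ℝ)).nsmul_mem (AddSubgroup.mem_zmultiples (1 : ℝ)) n

variable {N : ℕ} [NeZero N] {k : ℤ}

open ConjAct Pointwise in
/-- **The translates `f ∣_k r`, `r ∈ SL₂(ℤ)`, of a modular form `f ∈ M_k(Γ₁(N))` are modular forms
for `Γ(N)`** (with the same underlying function): `Γ(N)` is normal in `SL₂(ℤ)` and contained in
`Γ₁(N)`, and holomorphy/boundedness at all cusps are those of Mathlib's `ModularForm.translate`.
[folklore] -/
theorem exists_modularForm_Gamma_coe_eq_slash (f : ModularForm (Gamma1 N) k) (r : SL(2, ℤ)) :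
    ∃ G : ModularForm (Gamma N) k, (⇑G : ℍ → ℂ) = ⇑f ∣[k] r := by
  refine ⟨{ toFun := ⇑f ∣[k] r
            slash_action_eq' := ?_
            holo' := (ModularForm.translate f (r : GL (Fin 2) ℝ)).holo'
            bdd_at_cusps' := ?_ }, rfl⟩
  · -- invariance under `Γ(N)`
    intro γ hγ
    obtain ⟨g, hg, rfl⟩ := hγ
    have hconj : r * g * r⁻¹ ∈ Gamma1 N :=
      Gamma_le_Gamma1 N ((Gamma_normal N).conj_mem g hg r)
    have hinv : (⇑f) ∣[k] (mapGL ℝ (r * g * r⁻¹)) = ⇑f :=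
      SlashInvariantFormClass.slash_action_eq f _ ⟨r * g * r⁻¹, hconj, rfl⟩
    have hr : (⇑f) ∣[k] r = (⇑f) ∣[k] (mapGL ℝ r) := SL_slash _ r
    change ((⇑f) ∣[k] r) ∣[k] (mapGL ℝ g) = (⇑f) ∣[k] r
    rw [hr, ← SlashAction.slash_mul, ← map_mul, show r * g = r * g * r⁻¹ * r by group, map_mul,
      SlashAction.slash_mul, hinv]
  · -- boundedness at every cusp of `Γ(N)`, i.e. at every cusp of `SL₂(ℤ)`
    intro c hc γ hγ
    have hc' : IsCusp c 𝒮ℒ := (Subgroup.IsArithmetic.isCusp_iff_isCusp_SL2Z _).mp hc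
    have hmem : ((r : GL (Fin 2) ℝ))⁻¹ ∈ 𝒮ℒ := inv_mem ⟨r, rfl⟩
    exact (ModularForm.translate f (r : GL (Fin 2) ℝ)).bdd_at_cusps'
      (hc'.of_isFiniteRelIndex_conj hmem) γ hγ

end Translates

/-! ### `q`-expansions: finite products, and period `N` versus period `1` -/

section QExpansion

/-- The `q`-expansion (any period `h`) of a finite product of functions whose cusp functions are
analytic at `0` is the product of the `q`-expansions, and its cusp function is again analytic at
`0`. [folklore] -/
theorem qExpansion_finset_prod {ι : Type*} (s : Finset ι) (φ : ι → ℍ → ℂ) (h : ℝ)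
    (hφ : ∀ i ∈ s, AnalyticAt ℂ (cuspFunction h (φ i)) 0)
    (h1 : AnalyticAt ℂ (cuspFunction h (1 : ℍ → ℂ)) 0) :
    qExpansion h (∏ i ∈ s, φ i) = ∏ i ∈ s, qExpansion h (φ i) ∧
      AnalyticAt ℂ (cuspFunction h (∏ i ∈ s, φ i)) 0 := by
  classical
  induction s using Finset.induction_on with
  | empty => exact ⟨by rw [Finset.prod_empty, Finset.prod_empty, qExpansion_one], by simpa using h1⟩
  | insert a s ha ih =>
    have hφs : ∀ i ∈ s, AnalyticAt ℂ (cuspFunction h (φ i)) 0 :=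
      fun i hi ↦ hφ i (Finset.mem_insert_of_mem hi)
    obtain ⟨ih1, ih2⟩ := ih hφs
    have ha' := hφ a (Finset.mem_insert_self a s)
    rw [Finset.prod_insert ha, Finset.prod_insert ha]
    refine ⟨by rw [qExpansion_mul ha' ih2, ih1], ?_⟩
    rw [cuspFunction_mul ha'.continuousAt ih2.continuousAt]
    exact ha'.mul ih2

variable {Γ : Subgroup (GL (Fin 2) ℝ)} {k : ℤ} {F : Type*} [FunLike F ℍ ℂ]

/-- **Period `N` versus period `1`.** If `1` is a strict period of `Γ` and `N ≥ 1`, the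
`q_N`-expansion (`q_N = e^{2πiτ/N}`) of `f ∈ M_k(Γ)` is its `q`-expansion in the variable
`q = q_N^N`: `coeff m (qExpansion N f) = coeff (m/N) (qExpansion 1 f)` if `N ∣ m` and `0`
otherwise. [folklore] -/
theorem coeff_qExpansion_nat_eq [ModularFormClass F Γ k] (f : F)
    (h1 : Γ.strictPeriods = AddSubgroup.zmultiples 1) (N : ℕ) [NeZero N] (m : ℕ) :
    coeff m (qExpansion (N : ℝ) f) =
      if N ∣ m then coeff (m / N) (qExpansion 1 f) else 0 := by
  have hN0 : (0 : ℝ) < N := Nat.cast_pos.mpr (NeZero.pos N)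
  have hNper := natCast_mem_of_eq_zmultiples_one h1 N
  have h1per : (1 : ℝ) ∈ Γ.strictPeriods := by rw [h1]; exact AddSubgroup.mem_zmultiples _
  -- the coefficient sequence in `q_N`
  set c : ℕ → ℂ := fun m ↦ if N ∣ m then coeff (m / N) (qExpansion 1 f) else 0 with hc
  suffices hsum : ∀ τ : ℍ, HasSum (fun m ↦ c m • Function.Periodic.qParam (N : ℝ) τ ^ m) (f τ) by
    exact (ModularFormClass.qExpansion_coeff_unique hN0 hNper hsum m).symm
  intro τ
  have hq : Function.Periodic.qParam (N : ℝ) (τ : ℂ) ^ N = Function.Periodic.qParam 1 (τ : ℂ) := by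
    simp only [Function.Periodic.qParam, ← Complex.exp_nat_mul, Complex.ofReal_one, div_one,
      Complex.ofReal_natCast]
    congr 1
    have : (N : ℂ) ≠ 0 := Nat.cast_ne_zero.mpr (NeZero.ne N)
    field_simp
  have : Fact (IsCusp OnePoint.infty Γ) := ⟨Γ.isCusp_of_mem_strictPeriods one_pos h1per⟩
  have hbase := hasSum_qExpansion one_pos (SlashInvariantFormClass.periodic_comp_ofComplex f h1per)
    (ModularFormClass.holo f) (ModularFormClass.bdd_at_infty f) τ
  -- reindex along `n ↦ N n`
  have hinj : Function.Injective fun n : ℕ ↦ N * n := mul_right_injective₀ (NeZero.ne N)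
  rw [← hinj.hasSum_iff]
  · convert hbase using 1
    funext n
    simp only [Function.comp_apply, hc, dvd_mul_right, if_true,
      Nat.mul_div_cancel_left n (NeZero.pos N), pow_mul, hq]
  · intro m hm
    have : ¬ N ∣ m := by
      rintro ⟨n, rfl⟩
      exact hm ⟨n, rfl⟩
    simp [hc, this]

end QExpansion

/-! ### The norm argument -/

section Norm

variable {N : ℕ} [NeZero N] {k : ℤ}

/-- An integer whose image in `R` lies in a proper ideal `P ∋ p` is divisible by `p`, provided
`P ∩ ℤ ⊆ pℤ`; contrapositive bookkeeping used below. [folklore] -/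
theorem intCast_quotient_ne_zero {R : Subring ℂ} (P : Ideal R) {p : ℕ}
    (hPZ : ∀ m : ℤ, ((m : R) : R) ∈ P → (p : ℤ) ∣ m) {m : ℤ} (hm : ¬ (p : ℤ) ∣ m) :
    Ideal.Quotient.mk P (m : R) ≠ 0 := by
  rw [Ne, Ideal.Quotient.eq_zero_iff_mem]
  exact fun h ↦ hm (hPZ m h)

/-- **Sturm's congruence theorem for `Γ₁(N)`, norm step** (Murty 1997, §4; Sturm 1987, proof of
Thm. 1).  Let `f ∈ M_k(Γ₁(N))` have integer Fourier coefficients `zₙ` at `∞`, let `R ⊆ ℂ` be a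
subring and `P ⊆ R` a prime ideal with `p ∈ P` and `P ∩ ℤ ⊆ pℤ`, and suppose that every translate
`f ∣_k γ`, `γ ∈ SL₂(ℤ)`, admits a constant `A` such that `A · (f ∣_k γ)` has `q_N`-expansion with
coefficients in `R` and non-zero reduction modulo `P`.  If `p ∣ zₙ` for all
`n ≤ k[SL₂(ℤ) : Γ₁(N)]/12`, then `p ∣ zₙ` for all `n`: otherwise the `q_N`-expansion of the norm
`∏_r A_r (f ∣_k r⁻¹)` — a level-one form of weight `k[SL₂(ℤ) : Γ₁(N)]` — is a product of series over
`R` with non-zero reductions in the domain `(R ⧸ P)⟦X⟧`, the factor of `f` being divisible by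
`X^{N(⌊k[SL₂(ℤ):Γ₁(N)]/12⌋ + 1)}`, contradicting the level-one theorem
`levelOne_map_toSubring_qExpansion_eq_zero`. [cite: Murty1997, §4 (proof of Thm. 5)] -/
theorem dvd_of_translates_of_dvd (p : ℕ) (f : ModularForm (Gamma1 N) k) (z : ℕ → ℤ)
    (hz : ∀ n, coeff n (qExpansion 1 f) = z n) (R : Subring ℂ) (P : Ideal R) [P.IsPrime]
    (hpP : ((p : ℕ) : R) ∈ P) (hPZ : ∀ m : ℤ, ((m : R) : R) ∈ P → (p : ℤ) ∣ m)
    (htr : ∀ γ : SL(2, ℤ), ∃ (A : ℂ) (S : PowerSeries R),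
      S.map R.subtype = A • qExpansion (N : ℝ) (⇑f ∣[k] γ) ∧ S.map (Ideal.Quotient.mk P) ≠ 0)
    (hdiv : ∀ n ≤ (k * ((Gamma1 N).index : ℤ)).toNat / 12, (p : ℤ) ∣ z n) (n₀ : ℕ) :
    (p : ℤ) ∣ z n₀ := by
  classical
  by_contra hn₀
  /- 0. Notation and basic facts. -/
  have hN0 : (0 : ℝ) < N := Nat.cast_pos.mpr (NeZero.pos N)
  have hNpos : 0 < N := NeZero.pos N
  have hNΓ := natCast_mem_strictPeriods_Gamma N
  have h1Γ₁ : (Subgroup.map (mapGL ℝ) (Gamma1 N)).strictPeriods = AddSubgroup.zmultiples 1 :=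
    strictPeriods_Gamma1 N
  have h1SL : (𝒮ℒ).strictPeriods = AddSubgroup.zmultiples 1 := Subgroup.strictPeriods_SL2Z
  set π : R →+* R ⧸ P := Ideal.Quotient.mk P with hπ
  set B : ℕ := (k * ((Gamma1 N).index : ℤ)).toNat / 12 with hB
  -- `f ≠ 0`, hence `k ≥ 0`
  have hzn₀ : z n₀ ≠ 0 := fun h ↦ hn₀ (h ▸ dvd_zero _)
  have hk : 0 ≤ k := by
    by_contra hk
    push Not at hk
    have hf : f = 0 := ModularForm.isZero_of_neg_weight hk f
    apply hzn₀
    have := hz n₀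
    rw [hf, ModularForm.coe_zero, qExpansion_zero, map_zero] at this
    exact_mod_cast this.symm
  /- 1. The cosets `SL₂(ℤ)/Γ₁(N)` and the translates as forms on `Γ(N)`. -/
  let 𝒬 := 𝒮ℒ ⧸ (Subgroup.map (mapGL ℝ) (Gamma1 N)).subgroupOf 𝒮ℒ
  letI : Fintype 𝒬 := Fintype.ofFinite 𝒬
  have hcard : Nat.card 𝒬 = (Gamma1 N).index := card_quotient_subgroupOf_eq_index (Gamma1 N)
  choose rep hrep using fun q : 𝒬 ↦
    exists_coe_rangeRestrict_eq (𝒢 := Subgroup.map (mapGL ℝ) (Gamma1 N)) q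
  have hqf : ∀ q : 𝒬, quotientFunc f q = ⇑f ∣[k] (rep q)⁻¹ := fun q ↦ by
    conv_lhs => rw [← hrep q]
    exact quotientFunc_coe_rangeRestrict f (rep q)
  choose G hG using fun q : 𝒬 ↦ exists_modularForm_Gamma_coe_eq_slash f (rep q)⁻¹
  -- the identity coset
  set q₁ : 𝒬 := ((1 : 𝒮ℒ) : 𝒬) with hq₁
  have hq₁f : quotientFunc f q₁ = ⇑f := by
    change quotientFunc f ⟦(1 : 𝒮ℒ)⟧ = ⇑f
    rw [quotientFunc_mk]
    simp
  /- 2. The normalised expansions: `S q` over `R`, with `(S q).map subtype = A q • qExp_N (f|rep q⁻¹)`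
     and non-zero reduction; at the identity coset we take `A = 1` and the integer expansion. -/
  choose A₀ S₀ hS₀ hS₀' using fun q : 𝒬 ↦ htr (rep q)⁻¹
  -- the integer expansion of `f` in `q_N`
  set S₁ : PowerSeries R := PowerSeries.mk fun m ↦ if N ∣ m then ((z (m / N) : ℤ) : R) else 0
    with hS₁
  have hS₁map : S₁.map R.subtype = qExpansion (N : ℝ) ⇑f := by
    ext m
    rw [coeff_map, hS₁, coeff_mk, coeff_qExpansion_nat_eq f h1Γ₁ N m]
    split_ifs with hm
    · rw [hz]; simp
    · simp
  have hS₁' : S₁.map π ≠ 0 := by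
    intro h
    have h1 := (map_quotient_mk_eq_zero_iff P S₁).mp h (N * n₀)
    rw [hS₁, coeff_mk, if_pos (dvd_mul_right N n₀), Nat.mul_div_cancel_left n₀ hNpos] at h1
    exact intCast_quotient_ne_zero P hPZ hn₀ (Ideal.Quotient.eq_zero_iff_mem.mpr h1)
  have hS₁dvd : (X : PowerSeries (R ⧸ P)) ^ (N * (B + 1)) ∣ S₁.map π := by
    rw [X_pow_dvd_map_quotient_mk_iff]
    intro m hm
    rw [hS₁, coeff_mk]
    split_ifs with hNm
    · obtain ⟨j, rfl⟩ := hNm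
      rw [Nat.mul_div_cancel_left j hNpos]
      have hj : j ≤ B := by
        have : N * j < N * (B + 1) := hm
        have := Nat.lt_of_mul_lt_mul_left this
        omega
      obtain ⟨t, ht⟩ := hdiv j hj
      rw [ht, Int.cast_mul, Int.cast_natCast]
      exact P.mul_mem_right _ hpP
    · exact P.zero_mem
  -- the family
  let A : 𝒬 → ℂ := fun q ↦ if q = q₁ then 1 else A₀ q
  let S : 𝒬 → PowerSeries R := fun q ↦ if q = q₁ then S₁ else S₀ q
  have hSmap : ∀ q, (S q).map R.subtype = A q • qExpansion (N : ℝ) (quotientFunc f q) := by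
    intro q
    by_cases hq : q = q₁
    · simp only [S, A, hq, if_true, hq₁f, one_smul, hS₁map]
    · simp only [S, A, hq, if_false, hqf]
      exact hS₀ q
  have hS' : ∀ q, (S q).map π ≠ 0 := by
    intro q
    by_cases hq : q = q₁
    · simp only [S, hq, if_true]; exact hS₁'
    · simp only [S, hq, if_false]; exact hS₀' q
  /- 3. The product `Φ = ∏_q A q • f|rep q⁻¹ = (∏ A q) • norm f`. -/
  have hGq : ∀ q, (⇑(G q) : ℍ → ℂ) = quotientFunc f q := fun q ↦ by rw [hG, hqf]
  have hfactor : ∀ q, A q • quotientFunc f q = ⇑(A q • G q) := fun q ↦ by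
    rw [ModularForm.IsGLPos.coe_smul, hGq]
  have hanal0 : ∀ q, AnalyticAt ℂ (cuspFunction (N : ℝ) (quotientFunc f q)) 0 := fun q ↦ by
    rw [← hGq]
    exact ModularFormClass.analyticAt_cuspFunction_zero (G q) hN0 hNΓ
  have hanal : ∀ q ∈ (Finset.univ : Finset 𝒬),
      AnalyticAt ℂ (cuspFunction (N : ℝ) (A q • quotientFunc f q)) 0 := fun q _ ↦ by
    rw [hfactor]
    exact ModularFormClass.analyticAt_cuspFunction_zero (A q • G q) hN0 hNΓ
  have hone : AnalyticAt ℂ (cuspFunction (N : ℝ) (1 : ℍ → ℂ)) 0 := by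
    have := ModularFormClass.analyticAt_cuspFunction_zero (1 : ModularForm (Gamma N) 0) hN0 hNΓ
    simpa using this
  obtain ⟨hprod, -⟩ := qExpansion_finset_prod Finset.univ (fun q ↦ A q • quotientFunc f q) N
    hanal hone
  -- the level-one form `C • norm f`
  set C : ℂ := ∏ q, A q with hC
  set Fn : ModularForm 𝒮ℒ (k * Nat.card 𝒬) := C • ModularForm.norm 𝒮ℒ f with hFn
  have hFn_coe : (⇑Fn : ℍ → ℂ) = ∏ q, A q • quotientFunc f q := by
    funext τ
    rw [hFn, ModularForm.IsGLPos.coe_smul, ModularForm.coe_norm, Pi.smul_apply, Finset.prod_apply,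
      Finset.prod_apply, smul_eq_mul, hC]
    simp only [Pi.smul_apply, smul_eq_mul]
    rw [Finset.prod_mul_distrib]
  -- its weight as a natural number
  set w : ℕ := (k * Nat.card 𝒬).toNat with hw
  have hwk : (k * Nat.card 𝒬 : ℤ) = (w : ℤ) := (Int.toNat_of_nonneg (by positivity)).symm
  set F₁ : ModularForm 𝒮ℒ (w : ℤ) := Fn.mcast hwk with hF₁
  have hF₁_coe : (⇑F₁ : ℍ → ℂ) = ∏ q, A q • quotientFunc f q := hFn_coe
  have hw12 : w / 12 = B := by
    rw [hw, hB, hcard]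
  /- 4. The `q_N`-expansion of `F₁` is `(∏ S q).map subtype`. -/
  have hexpN : qExpansion (N : ℝ) ⇑F₁ = (∏ q, S q).map R.subtype := by
    rw [hF₁_coe, hprod, map_prod]
    refine Finset.prod_congr rfl fun q _ ↦ ?_
    rw [hSmap, qExpansion_smul (hanal0 q)]
  -- hence the `q`-expansion has coefficients in `R`
  have hcoeffN : ∀ m, coeff m (qExpansion (N : ℝ) ⇑F₁) = ((coeff m (∏ q, S q) : R) : ℂ) := by
    intro m
    rw [hexpN, coeff_map]
    rfl
  have hR : ∀ n, coeff n (qExpansion 1 ⇑F₁) ∈ R := by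
    intro n
    have h := coeff_qExpansion_nat_eq F₁ h1SL N (N * n)
    rw [if_pos (dvd_mul_right N n), Nat.mul_div_cancel_left n hNpos] at h
    rw [← h, hcoeffN]
    exact SetLike.coe_mem _
  set T : PowerSeries R := (qExpansion 1 ⇑F₁).toSubring R hR with hT
  have hTcoeff : ∀ n, coeff n T = coeff (N * n) (∏ q, S q) := by
    intro n
    apply Subtype.ext
    rw [hT, coeff_toSubring]
    have h := coeff_qExpansion_nat_eq F₁ h1SL N (N * n)
    rw [if_pos (dvd_mul_right N n), Nat.mul_div_cancel_left n hNpos] at h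
    rw [← h, hcoeffN]
  /- 5. Reduction modulo `P`: `T̄` is divisible by `X^{B+1}` and non-zero. -/
  haveI : IsDomain (R ⧸ P) := Ideal.Quotient.isDomain P
  have hprodbar : (∏ q, S q).map π = ∏ q, (S q).map π := map_prod _ _ _
  have hTdvd : (X : PowerSeries (R ⧸ P)) ^ (w / 12 + 1) ∣ T.map π := by
    rw [hw12, X_pow_dvd_map_quotient_mk_iff]
    intro n hn
    rw [hTcoeff]
    -- `X^{N(B+1)} ∣ ∏ S̄ q`, and `N n < N (B+1)`
    have hdvd : (X : PowerSeries (R ⧸ P)) ^ (N * (B + 1)) ∣ (∏ q, S q).map π := by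
      rw [hprodbar]
      refine (hS₁dvd.trans ?_)
      have : S₁ = S q₁ := by simp [S]
      rw [this]
      exact Finset.dvd_prod_of_mem (fun q ↦ (S q).map π) (Finset.mem_univ q₁)
    rw [X_pow_dvd_map_quotient_mk_iff] at hdvd
    exact hdvd (N * n) (Nat.mul_lt_mul_of_pos_left hn hNpos)
  have hTne : T.map π ≠ 0 := by
    -- `∏ S̄ q ≠ 0` in the domain `(R ⧸ P)⟦X⟧`
    have hne : (∏ q, S q).map π ≠ 0 := by
      rw [hprodbar]
      exact Finset.prod_ne_zero_iff.mpr fun q _ ↦ hS' q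
    obtain ⟨m, hm⟩ : ∃ m, coeff m ((∏ q, S q).map π) ≠ 0 := by
      by_contra h
      push Not at h
      exact hne (PowerSeries.ext fun m ↦ by simpa using h m)
    -- `N ∣ m`: the other coefficients of the `q_N`-expansion of the `1`-periodic `F₁` vanish
    have hNm : N ∣ m := by
      by_contra hNm
      apply hm
      have h := coeff_qExpansion_nat_eq F₁ h1SL N m
      rw [if_neg hNm, hcoeffN] at h
      have h' : coeff m (∏ q, S q) = 0 := by exact_mod_cast h
      rw [coeff_map, h', map_zero]
    obtain ⟨n, rfl⟩ := hNm
    intro hT0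
    apply hm
    rw [coeff_map, ← hTcoeff, ← coeff_map, hT0, map_zero]
  /- 6. The level-one congruence theorem gives `T̄ = 0`: contradiction. -/
  exact hTne (levelOne_map_toSubring_qExpansion_eq_zero R P w F₁ hR hTdvd)

end Norm

end Literature.NumberTheory.ModularForms

end
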